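import Summits.ResolutionOfSingularities.ResolutionOfSingularities.Theorems.HilbertSamuelEliminationSigmaMaxModificationsCorridor3SigmaCyclePlusDefs
import Summits.ResolutionOfSingularities.ResolutionOfSingularities.Theorems.HilbertSamuelEliminationCampaignW42TertiaryCycles
import HarnessLib

/-!
# [OURS · L1 W4.2] σ-LAYER — the CENTRE and CYCLE PACKAGES over the END-rule variant Ω⁺ (draft; cost item (3) of V8-b′)

DRAFT — not filed before res-L1-w42-plan-1's word on Ω⁺ (RULINGS v3.14-9 (CD)/(CF), 10:30Z). Ports of the tree's
`isCanonicalStep_centre_package` (…CampaignW42TertiaryInStratum) and `isCanonicalStep_cycle_package` (…CampaignW42TertiaryCycles) to the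
Ω⁺ step `IsCanonicalStepΩplus ω` of `…Corridor3SigmaCyclePlusDefs`, with the PENDING INVARIANT WEAKENED from «replayed subscheme = label
part» to «replayed subscheme ⊆ `ν`-stratum, label ≤ year, remaining centres regular, last stage regular» (the `replay` half of the tree's
package — `not_subset_image_support_of_isPermissible` — is exactly what Ω⁺ drops). OURS; NOT statements of the manuscript; AI-drafted.
-/

noncomputable section

set_option linter.dupNamespace false

open CategoryTheory AlgebraicGeometry TopologicalSpace Topology
open Summit.ResolutionOfSingularities.ResolutionOfSingularities.Theorems.CampaignW42
open Literature.AlgebraicGeometry.Resolution Literature.RingTheory.HilbertSamuel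
open Summit.ResolutionOfSingularities.ResolutionOfSingularities.Theorems.SigmaMaxModificationsCorridor3

namespace Summit.ResolutionOfSingularities.ResolutionOfSingularities.Theorems.SigmaMaxModificationsCorridor3.Sigma

universe u

variable {N : ℕ} {ν : ℕ → ℕ} {k : Type u} [Field k]

/-! ## §1. Replay-step geometry for `IsReplayStepPlus` -/

/-- The centre of an Ω⁺ replay step lies in `Y` as soon as the replayed subscheme does (END: `V(range φ)`; inside: the push-forward).
[cite: CossartJannsenSaito2020, Rem. 6.29 (1)] -/
theorem support_subset_of_isReplayStepPlus {W : Scheme.{u}} {L : Labelling W} {Y : Set W} (hY : IsClosed Y) {j : ℕ}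
    {S : Scheme.{u}} {φ : S ⟶ W} [QuasiCompact φ] (hφ : Set.range φ.base ⊆ Y) {t : CentreSeq S}
    {C : W.IdealSheafData} {P' : Option (Pending (blowup C))} (h : IsReplayStepPlus L Y j φ t C P') :
    (C.support : Set W) ⊆ Y := by
  cases t with
  | nil _ =>
    obtain ⟨⟨hcl, rfl⟩, -⟩ := h
    rw [Scheme.IdealSheafData.coe_support_vanishingIdeal]
    exact hφ
  | cons D t' =>
    have h' : IsReplayStep L Y j φ (CentreSeq.cons D t') C P' := h
    exact support_subset_of_isReplayStep hY hφ h'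

/-- Along an Ω⁺ replay step the next replayed subscheme lies in the next stratum (END: no next subscheme; inside: the tree's lemma).
[cite: CossartJannsenSaito2020, Rem. 6.29 (1), p. 92] [cite: GortzWedhorn2020, Prop. 13.96 (2)] -/
theorem range_hom_subset_hsStratum_of_isReplayStepPlus {W : Scheme.{u}} [IsLocallyNoetherian W] {L : Labelling W}
    {j : ℕ} {S : Scheme.{u}} {φ : S ⟶ W} [IsClosedImmersion φ]
    (hφ : Set.range φ.base ⊆ Scheme.hsStratum W N ν) {t : CentreSeq S} {C : W.IdealSheafData}
    [IsLocallyNoetherian (blowup C)] {P' : Option (Pending (blowup C))}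
    (h : IsReplayStepPlus L (Scheme.hsStratum W N ν) j φ t C P') (hcl : IsClosed (Scheme.hsStratum (blowup C) N ν)) :
    ∀ Q', P' = some Q' → Set.range Q'.hom.base ⊆ Scheme.hsStratum (blowup C) N ν := by
  cases t with
  | nil _ =>
    obtain ⟨-, rfl⟩ := h
    intro Q' hQ'
    exact absurd hQ' (by simp)
  | cons D t' =>
    have h' : IsReplayStep L (Scheme.hsStratum W N ν) j φ (CentreSeq.cons D t') C P' := h
    exact range_hom_subset_hsStratum_of_isReplayStep hφ h' hcl

/-- Along an Ω⁺ replay step from a regular remaining sequence, the next remaining sequence is regular with regular last stage, and its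
label is the cycle's. [folklore] -/
theorem pending_regular_of_isReplayStepPlus {W : Scheme.{u}} {L : Labelling W} {Y : Set W} {j : ℕ} {S : Scheme.{u}} {φ : S ⟶ W}
    {t : CentreSeq S} (ht : t.AllRegular) (htop : Literature.AlgebraicGeometry.Resolution.Scheme.IsRegular t.top)
    {C : W.IdealSheafData} {P' : Option (Pending (blowup C))} (h : IsReplayStepPlus L Y j φ t C P') :
    ∀ Q', P' = some Q' → Q'.lbl = j ∧ Q'.rest.AllRegular ∧ Literature.AlgebraicGeometry.Resolution.Scheme.IsRegular Q'.rest.top := by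
  cases t with
  | nil _ =>
    obtain ⟨-, rfl⟩ := h
    intro Q' hQ'
    exact absurd hQ' (by simp)
  | cons D t' =>
    obtain ⟨-, φ', hφ', -, hP'⟩ := (isReplayStepPlus_cons_iff L Y j φ D t' C P').mp h
    intro Q' hQ'
    obtain rfl : Q' = ⟨j, blowup D, φ', hφ', t'⟩ := Option.some_injective _ (hQ'.symm.trans hP')
    exact ⟨rfl, ((CentreSeq.allRegular_cons D t').mp ht).2, htop⟩

/-! ## §2. The centre package over Ω⁺ -/

/-- **ONE Ω⁺ STEP FROM A STATE OVER `k` — CENTRE PACKAGE** (port of `isCanonicalStep_centre_package`): stage of finite type over `k`,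
reduced, `dim ≤ N`, `ν` never exceeded, the replayed subscheme (if any) inside `W(ν)`; a REGULAR centre of an Ω⁺ step then lies in the
stratum, is PERMISSIBLE (regular + inside `X(ν)`, `ν ≠ Φ^{(N)}` maximal: tree `Helpers.isPermissible_of_isRegular_subscheme_…`), `H^N` does
not increase along its blow-up, and the geometric state propagates. [cite: CossartJannsenSaito2020, Rem. 6.29 (1), Thm. 3.3, Thm. 3.10 (1)] -/
theorem isCanonicalStepΩplus_centre_package {ω : StageOracle.{u}} (hν : ν ≠ iterPSum N Phi) {W : Scheme.{u}}
    (hW : IsLocallyNoetherian W) {L : Labelling W} {P : Option (Pending W)}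
    (hk : ∃ f : W ⟶ Spec (.of k), LocallyOfFiniteType f ∧ QuasiCompact f)
    (hred : IsReduced W) (hdim : topologicalKrullDim W ≤ (N : WithBot ℕ∞))
    (hsup : ∀ w : W, ν ≤ Scheme.hsFun W N w → Scheme.hsFun W N w = ν)
    (hinv : ∀ Q, P = some Q → Set.range Q.hom.base ⊆ Scheme.hsStratum W N ν)
    {C : W.IdealSheafData} {P' : Option (Pending (blowup C))} (hst : IsCanonicalStepΩplus ω hW N ν L P C P')
    (hCreg : Literature.AlgebraicGeometry.Resolution.Scheme.IsRegular C.subscheme) :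
    (C.support : Set W) ⊆ Scheme.hsStratum W N ν ∧ IdealSheafData.IsPermissible C ∧
      (∀ z : ↥(blowup C), Scheme.hsFun (blowup C) N z ≤ Scheme.hsFun W N ((blowup.π C).base z)) ∧
      (∃ f' : blowup C ⟶ Spec (.of k), LocallyOfFiniteType f' ∧ QuasiCompact f') ∧ IsReduced (blowup C) ∧
      topologicalKrullDim (blowup C) ≤ (N : WithBot ℕ∞) ∧
      (∀ z : ↥(blowup C), ν ≤ Scheme.hsFun (blowup C) N z → Scheme.hsFun (blowup C) N z = ν) ∧
      ∀ Q', P' = some Q' → Set.range Q'.hom.base ⊆ Scheme.hsStratum (blowup C) N ν := by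
  obtain ⟨f, hft, hqc⟩ := hk
  haveI := hft
  haveI := hqc
  haveI := hred
  haveI : IsNoetherian W := Scheme.isNoetherian_of_finiteType_over_field f
  have hexc : Scheme.IsExcellent W := Scheme.isExcellent_of_locallyOfFiniteType Stacks07QW_field_holds f
  have hYcl : IsClosed (Scheme.hsStratum W N ν) := by
    rw [hsStratum_eq_hsStratumGE_of_supMax hsup]
    exact isClosed_hsStratumGE_over_field f hdim ν
  -- (i) the centre lies in the stratum
  have hCsub : (C.support : Set W) ⊆ Scheme.hsStratum W N ν := by
    cases P with
    | none =>
      obtain ⟨j, -, hpart, t, -, hs⟩ := hst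
      refine support_subset_of_isReplayStepPlus hYcl ?_ hs
      rw [Scheme.IdealSheafData.range_subschemeι, Scheme.IdealSheafData.coe_support_vanishingIdeal]
      exact L.part_subset _ j
    | some Q =>
      haveI := Q.isClosedImmersion
      exact support_subset_of_isReplayStepPlus hYcl (hinv Q rfl) hst.2
  -- (ii) permissible
  have hperm : IdealSheafData.IsPermissible C :=
    Helpers.isPermissible_of_isRegular_subscheme_of_support_subset_hsStratum_of_isExcellent hexc hdim hν C hCreg hCsub
  -- (iii) `H^N` monotone, next state
  haveI : IsProper (blowup.π C) := (blowup.isBlowup C).isProper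
  haveI : IsLocallyNoetherian (blowup C) := LocallyOfFiniteType.isLocallyNoetherian (blowup.π C ≫ f)
  have hmono : ∀ z : ↥(blowup C), Scheme.hsFun (blowup C) N z ≤ Scheme.hsFun W N ((blowup.π C).base z) :=
    fun z => (blowup.isBlowup C).hsFun_le_of_isPermissible hexc hperm N z
  have hsup' : ∀ z : ↥(blowup C), ν ≤ Scheme.hsFun (blowup C) N z → Scheme.hsFun (blowup C) N z = ν := by
    intro z hz
    have hle := hmono z
    have heq := hsup _ (hz.trans hle)
    exact le_antisymm (heq ▸ hle) hz
  have hdim' : topologicalKrullDim (blowup C) ≤ (N : WithBot ℕ∞) :=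
    (blowup.isBlowup C).topologicalKrullDim_le_of_isLocallyNoetherian hdim
  have hYcl' : IsClosed (Scheme.hsStratum (blowup C) N ν) := by
    rw [hsStratum_eq_hsStratumGE_of_supMax hsup']
    exact isClosed_hsStratumGE_over_field (blowup.π C ≫ f) hdim' ν
  refine ⟨hCsub, hperm, hmono, ⟨blowup.π C ≫ f, inferInstance, inferInstance⟩,
    (blowup.isBlowup C).isReduced_of_isReduced, hdim', hsup', ?_⟩
  -- (iv) the new replayed subscheme lies in the new stratum
  cases P with
  | none =>
    obtain ⟨j, -, hpart, t, -, hs⟩ := hst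
    refine range_hom_subset_hsStratum_of_isReplayStepPlus ?_ hs hYcl'
    rw [Scheme.IdealSheafData.range_subschemeι, Scheme.IdealSheafData.coe_support_vanishingIdeal]
    exact L.part_subset _ j
  | some Q =>
    haveI := Q.isClosedImmersion
    exact range_hom_subset_hsStratum_of_isReplayStepPlus (hinv Q rfl) hst.2 hYcl'

/-! ## §3. The cycle package over Ω⁺ (weak pending invariant) -/

/-- **ONE Ω⁺ STEP UNDER THE (WEAK) CYCLE INVARIANT, ADMISSIBLE STAGE ORACLE** (port of `isCanonicalStep_cycle_package` without its
`replay` half): state = finite type over `k`, reduced, `dim ≤ N`, `ν` never exceeded, labels `≤` year, and INSIDE A CYCLE the replayed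
subscheme lies in the stratum, its label is `≤` the year, the remaining centres are REGULAR and the replayed last stage is REGULAR. Then
the Ω⁺ centre is regular, lies in the stratum, is permissible, `H^N` does not increase, and the invariant holds at the next state.
[cite: CossartJannsenSaito2020, Rem. 6.29 (1), p. 92, Thm. 3.3, Thm. 3.10 (1)] -/
theorem isCanonicalStepΩplus_cycle_package {ω : StageOracle.{u}} (hω : OracleAdmissibleΩplus ω) (hν : ν ≠ iterPSum N Phi)
    {W : Scheme.{u}} (hW : IsLocallyNoetherian W) {L : Labelling W} {P : Option (Pending W)}
    (hk : ∃ f : W ⟶ Spec (.of k), LocallyOfFiniteType f ∧ QuasiCompact f)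
    (hred : IsReduced W) (hdim : topologicalKrullDim W ≤ (N : WithBot ℕ∞))
    (hsup : ∀ w : W, ν ≤ Scheme.hsFun W N w → Scheme.hsFun W N w = ν) (hlab : ∀ Z, L.label Z ≤ L.year)
    (hpend : ∀ Q, P = some Q → Set.range Q.hom.base ⊆ Scheme.hsStratum W N ν ∧ Q.lbl ≤ L.year ∧
      Q.rest.AllRegular ∧ Literature.AlgebraicGeometry.Resolution.Scheme.IsRegular Q.rest.top)
    {C : W.IdealSheafData} {P' : Option (Pending (blowup C))} (hst : IsCanonicalStepΩplus ω hW N ν L P C P') :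
    Literature.AlgebraicGeometry.Resolution.Scheme.IsRegular C.subscheme ∧ (C.support : Set W) ⊆ Scheme.hsStratum W N ν ∧
      IdealSheafData.IsPermissible C ∧
      (∀ z : ↥(blowup C), Scheme.hsFun (blowup C) N z ≤ Scheme.hsFun W N ((blowup.π C).base z)) ∧
      (∃ f' : blowup C ⟶ Spec (.of k), LocallyOfFiniteType f' ∧ QuasiCompact f') ∧ IsReduced (blowup C) ∧
      topologicalKrullDim (blowup C) ≤ (N : WithBot ℕ∞) ∧
      (∀ z : ↥(blowup C), ν ≤ Scheme.hsFun (blowup C) N z → Scheme.hsFun (blowup C) N z = ν) ∧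
      (∀ Z, (L.next (Scheme.hsStratum W N ν) C).label Z ≤ (L.next (Scheme.hsStratum W N ν) C).year) ∧
      ∀ Q', P' = some Q' →
        Set.range Q'.hom.base ⊆ Scheme.hsStratum (blowup C) N ν ∧
          Q'.lbl ≤ (L.next (Scheme.hsStratum W N ν) C).year ∧ Q'.rest.AllRegular ∧
          Literature.AlgebraicGeometry.Resolution.Scheme.IsRegular Q'.rest.top := by
  obtain ⟨f, hft, hqc⟩ := hk
  haveI := hft
  haveI := hqc
  haveI := hred
  haveI : IsNoetherian W := Scheme.isNoetherian_of_finiteType_over_field f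
  -- a label carried by a component is not newer than the year
  have hlabel_le : ∀ j, (L.part (Scheme.hsStratum W N ν) j).Nonempty → j ≤ L.year := by
    rintro j ⟨y, hy⟩
    obtain ⟨Z, -, hl, -⟩ := (L.mem_part_iff _ j y).mp hy
    exact hl ▸ hlab Z
  -- (0) the centre is regular, and the next pending state's regularity data / label
  have hpack : Literature.AlgebraicGeometry.Resolution.Scheme.IsRegular C.subscheme ∧
      ∀ Q', P' = some Q' → Q'.lbl ≤ L.year ∧ Q'.rest.AllRegular ∧
        Literature.AlgebraicGeometry.Resolution.Scheme.IsRegular Q'.rest.top := by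
    cases P with
    | none =>
      obtain ⟨j, hj, hcl, t, hRt, hs⟩ := hst
      obtain ⟨htreg, httop⟩ := hω _ _ _ _ _ _ _ _ hRt
      haveI : IsLocallyNoetherian (Scheme.IdealSheafData.vanishingIdeal
          ⟨L.part (Scheme.hsStratum W N ν) j, hcl⟩).subscheme :=
        LocallyOfFiniteType.isLocallyNoetherian (Scheme.IdealSheafData.vanishingIdeal
          ⟨L.part (Scheme.hsStratum W N ν) j, hcl⟩).subschemeι
      refine ⟨?_, fun Q' hQ' => ?_⟩
      · cases t with
        | nil _ =>
          obtain ⟨⟨h', rfl⟩, -⟩ := hs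
          exact isRegular_subscheme_vanishingIdeal_range _ httop
        | cons D t' =>
          obtain ⟨rfl, -⟩ := (isReplayStepPlus_cons_iff L _ j _ D t' C P').mp hs
          exact isRegular_subscheme_map_of_isClosedImmersion _ D ((CentreSeq.allRegular_cons D t').mp htreg).1
      · obtain ⟨hl, hr, ht⟩ := pending_regular_of_isReplayStepPlus htreg httop hs Q' hQ'
        exact ⟨hl ▸ hlabel_le j hj.1, hr, ht⟩
    | some Q =>
      haveI := Q.isClosedImmersion
      obtain ⟨hrange, hlbl, hrestreg, hresttop⟩ := hpend Q rfl
      obtain ⟨-, hs⟩ := hst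
      haveI : IsLocallyNoetherian Q.src := LocallyOfFiniteType.isLocallyNoetherian Q.hom
      refine ⟨?_, fun Q' hQ' => ?_⟩
      · revert hs hrestreg hresttop
        cases Q.rest with
        | nil _ =>
          intro hrestreg hresttop hs
          obtain ⟨⟨h', rfl⟩, -⟩ := hs
          exact isRegular_subscheme_vanishingIdeal_range Q.hom hresttop
        | cons D t' =>
          intro hrestreg hresttop hs
          obtain ⟨rfl, -⟩ := (isReplayStepPlus_cons_iff L _ Q.lbl Q.hom D t' C P').mp hs
          exact isRegular_subscheme_map_of_isClosedImmersion _ D ((CentreSeq.allRegular_cons D t').mp hrestreg).1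
      · obtain ⟨hl, hr, ht⟩ := pending_regular_of_isReplayStepPlus hrestreg hresttop hs Q' hQ'
        exact ⟨hl ▸ hlbl, hr, ht⟩
  obtain ⟨hCreg, hnext⟩ := hpack
  -- (1)–(3) centre in the stratum, permissible, `H^N` monotone, next state over `k`
  obtain ⟨hCsub, hperm, hmono, hk', hred', hdim', hsup', hinv'⟩ :=
    isCanonicalStepΩplus_centre_package (k := k) hν hW ⟨f, hft, hqc⟩ hred hdim hsup (fun Q hQ => (hpend Q hQ).1) hst hCreg
  -- (4) labels stay `≤` year
  have hlab' : ∀ Z, (L.next (Scheme.hsStratum W N ν) C).label Z ≤ (L.next (Scheme.hsStratum W N ν) C).year := by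
    intro Z
    rw [Labelling.next_year]
    by_cases h : closure (blowup.π C '' Z) ∈ componentsIn (Scheme.hsStratum W N ν)
    · rw [L.next_label_of_mem C h]
      exact (hlab _).trans (Nat.le_succ _)
    · rw [L.next_label_of_not_mem C h]
  refine ⟨hCreg, hCsub, hperm, hmono, hk', hred', hdim', hsup', hlab', fun Q' hQ' => ?_⟩
  obtain ⟨hl, hr, ht⟩ := hnext Q' hQ'
  refine ⟨hinv' Q' hQ', ?_, hr, ht⟩
  rw [Labelling.next_year]
  exact hl.trans (Nat.le_succ _)

end Summit.ResolutionOfSingularities.ResolutionOfSingularities.Theorems.SigmaMaxModificationsCorridor3.Sigma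

end
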